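import Summits.KontsevichZagierPeriods.KontsevichZagierPeriods.Theorems.LinRedNormalFormArrangementNormalFormStubRebaseSimpleZeroManyChainPinch
import Summits.KontsevichZagierPeriods.KontsevichZagierPeriods.Theorems.LinRedNormalFormArrangementNormalFormStubRebaseSimpleZeroNestedDissect

/-!
# Stub `stub_rebaseSimpleZeroMany`, part `rebaseSimpleZeroMany_common` (crux `ArrangementNormalForm`,
line `janus-bands`) — brick `ChainDissect`

**The dissection of the base interval** of a clean chain `A(y) < t₀ < ⋯ < tₙ < B(y)` of `n + 1`
fibres with constant letters and a simple base pole (`RebaseChain.IsChain`): UNCONDITIONALLY the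
chain is good for the enlarged target `GG 0 2 (n + 1) ∪ RebaseChain.mixedSet n`
(`IsChain.goodM`), hence good for `GG 0 2 (n + 1)` under the hypothesis `RebaseChain.PinchMixed n`
(`IsChain.good_of_pinchMixed`; the `K`-fibre version of brick `NestedDissect`):
* parallel bounds (`A' = B'`): empty fibres or a THICK chain (`IsChain.good_thick`, explicit grid
  of separable pieces);
* otherwise the bounds meet at the rational pinch point `y₀ = (A₀ − B₀)/(B' − A')`; cut the base
  at `y₀` and at `y₀ ± ε` (rule 1a, `IsChain.rowSplit`) with the explicit `ε` of
  `RebaseChain.pinch_side` on each side: the two near pieces are good by `pinch_side`, the two far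
  pieces have empty fibres or are thick.
Then `RebaseChain.goodM_cleanChain` / `good_cleanChain`: a clean chain with letters of a COMMON
`y`-slope `λ` (literal `GS 0 (n + 1)` datum) is good for `GG 0 2 (n + 1) ∪ mixedSet n`, resp. for
`GG 0 2 (n + 1)` under `PinchMixed n` — joint shear `RebaseChain.shear`, then the dissection.
Registered: `rebaseSimpleZeroMany_cleanChainMixed` (unconditional) and
`rebaseSimpleZeroMany_cleanChain` (literal binders).

References: M. Kontsevich, D. Zagier, *Periods* (2001), §1.2, rules (1a), (2).
-/

noncomputable section

open Set MeasureTheory MvPolynomial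
open Literature.NumberTheory.Transcendental Literature.ModelTheory.ExponentialFields

namespace Summit.KontsevichZagierPeriods.ArrangementNormalForm.JanusBands

namespace RebaseChain

open SeparatePos RebasePos RebaseZero RebaseNest

variable {n m' : ℕ} {s : KZ.IntegralRep (0 + 1 + (n + 1))} {M : Fin m' → Cf} {A Bd : Cf} {T : BData}
  {p : MvPolynomial (Fin 0) ℚ} {a : Fin (n + 1) → Option Cf}

/-- **The dissection of the base interval.** A clean chain of `n + 1` fibres over a
one-dimensional base with constant letters and a simple base pole is good for the enlarged
target `GG 0 2 (n + 1) ∪ mixedSet n`. [Kontsevich–Zagier 2001, §1.2, rules (1), (2)] -/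
theorem IsChain.goodM (hN : IsChain s M A Bd T p a) : GoodM n (KZ.of s) := by
  by_cases hαβ : A.1 (Fin.last 0) = Bd.1 (Fin.last 0)
  · -- parallel bounds
    have hD : ∀ y : ℝ, ev Bd y - ev A y = ((Bd.2 - A.2 : ℚ) : ℝ) := fun y => by
      have : (A.1 (Fin.last 0) : ℝ) = Bd.1 (Fin.last 0) := by exact_mod_cast hαβ
      simp only [ev, Rat.cast_sub, this]
      ring
    by_cases hd : Bd.2 - A.2 ≤ 0
    · refine goodM_of_good (hN.good_empty fun y _ => ?_)
      have h0 : ((Bd.2 - A.2 : ℚ) : ℝ) ≤ 0 := by exact_mod_cast hd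
      linarith [hD y]
    · exact goodM_of_good (hN.good_thick (Bd.2 - A.2) (not_le.1 hd) fun y _ => (hD y).ge)
  -- the pinch point
  have hne : Bd.1 (Fin.last 0) - A.1 (Fin.last 0) ≠ 0 := sub_ne_zero.2 (Ne.symm hαβ)
  set y₀ : ℚ := (A.2 - Bd.2) / (Bd.1 (Fin.last 0) - A.1 (Fin.last 0)) with hy₀
  set t₀ : ℚ := A.1 (Fin.last 0) * y₀ + A.2 with ht₀
  have hA0 : A.1 (Fin.last 0) * y₀ + A.2 = t₀ := rfl
  have hB0 : Bd.1 (Fin.last 0) * y₀ + Bd.2 = t₀ := by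
    have : (Bd.1 (Fin.last 0) - A.1 (Fin.last 0)) * y₀ = A.2 - Bd.2 := by
      rw [hy₀]; field_simp
    rw [ht₀]; linarith
  have hD : ∀ y : ℝ, ev Bd y - ev A y = ((Bd.1 (Fin.last 0) : ℝ) - A.1 (Fin.last 0)) * (y - y₀) :=
    ev_sub_vertex hA0 hB0
  -- the explicit caps on both sides
  obtain ⟨εR, hεR, hgoodR⟩ := pinch_side (ε₁ := 1) T a (Or.inl rfl) hA0 hB0 M (RebaseZero.mk 1 (-y₀))
    fun y => by rw [ev_mk]; push_cast; ring
  obtain ⟨εL, hεL, hgoodL⟩ := pinch_side (ε₁ := -1) T a (Or.inr rfl) hA0 hB0 M (-RebaseZero.mk 1 (-y₀))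
    fun y => by rw [ev_neg, ev_mk]; push_cast; ring
  have hεR' : (0 : ℝ) < εR := by exact_mod_cast hεR
  have hεL' : (0 : ℝ) < εL := by exact_mod_cast hεL
  refine hN.rowSplitM (RebaseZero.mk 1 (-y₀)) (mk_ne_zero one_ne_zero _) (fun s₁ h₁ => ?_) (fun s₂ h₂ => ?_)
  · -- the right side `y > y₀`
    refine h₁.rowSplitM (RebaseZero.mk (-1) (1 * y₀ + εR)) (mk_ne_zero (by norm_num) _)
      (fun s₃ h₃ => hgoodR s₃ p h₃) fun s₄ h₄ => ?_
    -- the far piece `y > y₀ + εR`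
    have hfar : ∀ y ∈ cell (Fin.snoc (Fin.snoc M (RebaseZero.mk 1 (-y₀)) : Fin (m' + 1) → Cf)
        (-RebaseZero.mk (-1) (1 * y₀ + εR)) : Fin (m' + 2) → Cf), (εR : ℝ) < y - y₀ := fun y hy => by
      rw [mem_cell_snoc_snoc] at hy
      obtain ⟨-, -, h2⟩ := hy
      rw [ev_neg, ev_mk] at h2
      push_cast at h2
      linarith
    rcases lt_or_gt_of_ne hαβ with hlt | hgt
    · refine goodM_of_good (h₄.good_thick ((Bd.1 (Fin.last 0) - A.1 (Fin.last 0)) * εR)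
        (mul_pos (sub_pos.2 hlt) hεR) fun y hy => ?_)
      have hlt' : (A.1 (Fin.last 0) : ℝ) < Bd.1 (Fin.last 0) := by exact_mod_cast hlt
      rw [hD y, Rat.cast_mul, Rat.cast_sub]
      nlinarith [hfar y hy]
    · refine goodM_of_good (h₄.good_empty fun y hy => ?_)
      have hgt' : (Bd.1 (Fin.last 0) : ℝ) < A.1 (Fin.last 0) := by exact_mod_cast hgt
      nlinarith [hfar y hy, hD y, hεR']
  · -- the left side `y < y₀`
    refine h₂.rowSplitM (RebaseZero.mk (-(-1)) (-1 * y₀ + εL)) (mk_ne_zero (by norm_num) _)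
      (fun s₃ h₃ => hgoodL s₃ p h₃) fun s₄ h₄ => ?_
    -- the far piece `y < y₀ - εL`
    have hfar : ∀ y ∈ cell (Fin.snoc (Fin.snoc M (-RebaseZero.mk 1 (-y₀)) : Fin (m' + 1) → Cf)
        (-RebaseZero.mk (-(-1)) (-1 * y₀ + εL)) : Fin (m' + 2) → Cf), (εL : ℝ) < y₀ - y := fun y hy => by
      rw [mem_cell_snoc_snoc] at hy
      obtain ⟨-, -, h2⟩ := hy
      rw [ev_neg, ev_mk] at h2
      push_cast at h2
      linarith
    rcases lt_or_gt_of_ne hαβ with hlt | hgt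
    · refine goodM_of_good (h₄.good_empty fun y hy => ?_)
      have hlt' : (A.1 (Fin.last 0) : ℝ) < Bd.1 (Fin.last 0) := by exact_mod_cast hlt
      nlinarith [hfar y hy, hD y, hεL']
    · refine goodM_of_good (h₄.good_thick ((A.1 (Fin.last 0) - Bd.1 (Fin.last 0)) * εL)
        (mul_pos (sub_pos.2 hgt) hεL) fun y hy => ?_)
      have hgt' : (Bd.1 (Fin.last 0) : ℝ) < A.1 (Fin.last 0) := by exact_mod_cast hgt
      rw [hD y, Rat.cast_mul, Rat.cast_sub]
      nlinarith [hfar y hy]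

/-- **The dissection under the mixed pinch hypothesis**: a clean chain of `n + 1` fibres with
constant letters and a simple base pole is good for `GG 0 2 (n + 1)`, given `PinchMixed n`. -/
theorem IsChain.good_of_pinchMixed (hB : PinchMixed n) (hN : IsChain s M A Bd T p a) :
    Good (n + 1) (KZ.of s) :=
  good_of_goodM hB hN.goodM

/-- **Clean chains with letters of a common `y`-slope are good modulo the mixed configurations.**
A representation with a literal `GS 0 (n + 1)` datum (simple base pole: `n₁ = 0`, `n₂ = 1`) whose
fibres form the clean chain `A < t₀ < ⋯ < tₙ < B` and whose letters have the common `y`-slope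
`λ` is good for `GG 0 2 (n + 1) ∪ mixedSet n`: joint shear along `λ` (`RebaseChain.shear`), then
the dissection of the base interval (`IsChain.goodM`). [Kontsevich–Zagier 2001, §1.2, rules (1), (2)] -/
theorem goodM_cleanChain {m n₁ n₂ : ℕ} (s : KZ.IntegralRep (0 + 1 + (n + 1)))
    (M : Fin m' → Cf) (L : Fin m → (Fin 0 → ℚ) × ℚ) (e : Fin m → ℕ) (p : MvPolynomial (Fin 0) ℚ)
    (ℓ₁ ℓ₂ : (Fin 0 → ℚ) × ℚ) (a : Fin (n + 1) → Option Cf) (A Bd : Cf) (h1 : n₁ = 0) (hn : n₂ = 1)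
    (hbd : Bornology.IsBounded s.domain) (hdom : s.domain = gDom 0 (n + 1) m' M (clo A) (chi Bd))
    (hint : EqOn s.integrand (glit 0 (n + 1) p L e ℓ₁ ℓ₂ n₁ n₂ a) s.domain)
    (lam : ℚ) (ha : ∀ l c, a l = some c → c.1 (Fin.last 0) = lam) : GoodM n (KZ.of s) := by
  obtain ⟨s', hN, hrel⟩ := shear s M L e p ℓ₁ ℓ₂ a A Bd h1 hn hbd hdom hint lam ha
  exact goodM_of_sub_mem hrel hN.goodM

/-- **Clean chains with letters of a common `y`-slope are good for `GG 0 2 (n + 1)`**, given the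
mixed pinch hypothesis `PinchMixed n` (corollary of `goodM_cleanChain`). -/
theorem good_cleanChain (hB : PinchMixed n) {m n₁ n₂ : ℕ} (s : KZ.IntegralRep (0 + 1 + (n + 1)))
    (M : Fin m' → Cf) (L : Fin m → (Fin 0 → ℚ) × ℚ) (e : Fin m → ℕ) (p : MvPolynomial (Fin 0) ℚ)
    (ℓ₁ ℓ₂ : (Fin 0 → ℚ) × ℚ) (a : Fin (n + 1) → Option Cf) (A Bd : Cf) (h1 : n₁ = 0) (hn : n₂ = 1)
    (hbd : Bornology.IsBounded s.domain) (hdom : s.domain = gDom 0 (n + 1) m' M (clo A) (chi Bd))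
    (hint : EqOn s.integrand (glit 0 (n + 1) p L e ℓ₁ ℓ₂ n₁ n₂ a) s.domain)
    (lam : ℚ) (ha : ∀ l c, a l = some c → c.1 (Fin.last 0) = lam) : Good (n + 1) (KZ.of s) :=
  good_of_goodM hB (goodM_cleanChain s M L e p ℓ₁ ℓ₂ a A Bd h1 hn hbd hdom hint lam ha)

end RebaseChain

/-- Registered support goal of this file (part of `rebaseSimpleZeroMany_common`), UNCONDITIONAL:
clean chains `A < t₀ < ⋯ < tₙ < B` of `n + 1` fibres with letters of a common `y`-slope over a
one-dimensional base (literal `GS 0 (n + 1)` datum) are congruent modulo `KZ.relations` to the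
subgroup generated by `GG 0 2 (n + 1)` and the mixed pinch configurations `RebaseChain.mixedSet n`
(`RebaseChain.goodM_cleanChain`). -/
theorem rebaseSimpleZeroMany_cleanChainMixed (n m m' n₁ n₂ : ℕ) (s : KZ.IntegralRep (0 + 1 + (n + 1))) (M : Fin m' → (Fin (0 + 1) → ℚ) × ℚ) (L : Fin m → (Fin 0 → ℚ) × ℚ) (e : Fin m → ℕ) (p : MvPolynomial (Fin 0) ℚ) (ℓ₁ ℓ₂ : (Fin 0 → ℚ) × ℚ) (a : Fin (n + 1) → Option ((Fin (0 + 1) → ℚ) × ℚ)) (A Bd : (Fin (0 + 1) → ℚ) × ℚ) (h1 : n₁ = 0) (hn : n₂ = 1) (hbd : Bornology.IsBounded s.domain) (hdom : s.domain = SeparatePos.gDom 0 (n + 1) m' M (RebaseChain.clo A) (RebaseChain.chi Bd)) (hint : EqOn s.integrand (RebasePos.glit 0 (n + 1) p L e ℓ₁ ℓ₂ n₁ n₂ a) s.domain) (lam : ℚ) (ha : ∀ l c, a l = some c → c.1 (Fin.last 0) = lam) : ∃ c ∈ AddSubgroup.closure (SeparatePos.GGset 0 2 (n + 1) ∪ RebaseChain.mixedSet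 n), KZ.of s - c ∈ KZ.relations :=
  RebaseChain.goodM_cleanChain s M L e p ℓ₁ ℓ₂ a A Bd h1 hn hbd hdom hint lam ha

/-- Registered support goal of this file (part of `rebaseSimpleZeroMany_common`): clean chains
`A < t₀ < ⋯ < tₙ < B` of `n + 1` fibres with letters of a common `y`-slope over a
one-dimensional base (literal `GS 0 (n + 1)` datum) are good for `GG 0 2 (n + 1)`, given the
mixed pinch configuration `RebaseChain.PinchMixed n` (`RebaseChain.good_cleanChain`). -/
theorem rebaseSimpleZeroMany_cleanChain (n : ℕ) (hB : RebaseChain.PinchMixed n) (m m' n₁ n₂ : ℕ) (s : KZ.IntegralRep (0 + 1 + (n + 1))) (M : Fin m' → (Fin (0 + 1) → ℚ) × ℚ) (L : Fin m → (Fin 0 → ℚ) × ℚ) (e : Fin m → ℕ) (p : MvPolynomial (Fin 0) ℚ) (ℓ₁ ℓ₂ : (Fin 0 → ℚ) × ℚ) (a : Fin (n + 1) → Option ((Fin (0 + 1) → ℚ) × ℚ)) (A Bd : (Fin (0 + 1) → ℚ) × ℚ) (h1 : n₁ = 0) (hn : n₂ = 1) (hbd : Bornology.IsBounded s.domain) (hdom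 : s.domain = {z | (∀ j, 0 < ∑ i, ((M j).1 i : ℝ) * z (Fin.castAdd (n + 1) i) + ((M j).2 : ℝ)) ∧ ∀ i, Sum.elim (fun j => z (Fin.natAdd (0 + 1) j)) (fun c => ∑ i', (c.1 i' : ℝ) * z (Fin.castAdd (n + 1) i') + (c.2 : ℝ)) (RebaseChain.clo A i) < z (Fin.natAdd (0 + 1) i) ∧ z (Fin.natAdd (0 + 1) i) < Sum.elim (fun j => z (Fin.natAdd (0 + 1) j)) (fun c => ∑ i', (c.1 i' : ℝ) * z (Fin.castAdd (n + 1) i') + (c.2 : ℝ)) (RebaseChain.chi Bd i)}) (hint : EqOn s.integrand (fun z => MvPolynomial.aeval (fun i => z (Fin.castAdd (n + 1) (Fin.castSucc i))) p / (∏ j, (∑ i, ((L j).1 i : ℝ) * z (Fin.castAdd (n + 1) (Fin.castSucc i)) + ((L j).2 : ℝ)) ^ e j) * ((z (Fin.castAdd (n + 1) (Fin.last 0)) - (∑ i, (ℓ₁.1 i : ℝ) * z (Fin.castAdd (n + 1) (Fin.castSucc i)) + (ℓ₁.2 : ℝ))) ^ n₁ / (z (Fin.castAdd (n + 1) (Fin.last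 0)) - (∑ i, (ℓ₂.1 i : ℝ) * z (Fin.castAdd (n + 1) (Fin.castSucc i)) + (ℓ₂.2 : ℝ))) ^ n₂) * ∏ i, (a i).elim 1 (fun c => 1 / (z (Fin.natAdd (0 + 1) i) - (∑ i', (c.1 i' : ℝ) * z (Fin.castAdd (n + 1) i') + (c.2 : ℝ))))) s.domain) (lam : ℚ) (ha : ∀ l c, a l = some c → c.1 (Fin.last 0) = lam) : ∃ c ∈ AddSubgroup.closure (SeparatePos.GGset 0 2 (n + 1)), KZ.of s - c ∈ KZ.relations :=
  RebaseChain.good_cleanChain hB s M L e p ℓ₁ ℓ₂ a A Bd h1 hn hbd hdom hint lam ha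

end Summit.KontsevichZagierPeriods.ArrangementNormalForm.JanusBands
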